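import Literature.Probability.RandomPlanarGeometry.ConformalRectangleProofs

/-!
# Prelims for stub S5b `stub_clusterLawOfComparison` of line `Sketch` (crux `DyadicLatticeBetaLaw`,
# stmt-CriticalPhenomena-18183, route DyadicBetaRigidity of `CardyFormulaZ2`)

Pure bookkeeping, elementary real analysis only: the **abstract cluster law from comparison**.
The percolation content of stub S5b is abstracted into a predicate `L t u` ("`u : ℕ → ℝ` is the
dyadic crossing sequence `k ↦ P[R, h/2^k]` of a lattice polygon `R` of `hℤ²` of conformal modulus
`t`"), two box families `b w`, `b' w : ℕ → ℝ` (the left–right and bottom–top crossing sequences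
`k ↦ P[Q w, 1/2^k]`, `k ↦ P[Q' w, 1/2^k]` of the boxes `(0,w) × (0,1)`), the modulus `eta w` of the
box `Q w`, a strictly divergent index sequence `k n` (the sub-subsequence `κ (σ n)`) and the box
limits `g w` along it.  The hypotheses are:

* comparison (stub S1): ladders of moduli `θ(ε,t)`-close to `t ∈ (0,1)` are eventually `ε`-close;
* refinement: the `j`-shift of a ladder is a ladder of the same modulus (`h ↦ h/2^j`);
* moduli of ladders lie in `(0,1)`;
* the `m`-shifted box sequences of a dyadic width `w = a/2^m` are ladders of modulus `eta w`,
  resp. `1 - eta w` (lattice boxes are lattice polygons; the flip of `stub_rectangleFamily`);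
* box limits (stub S5a): `b w (k n) → g w`, `b' w (k n) → 1 - g w` for every real `w > 0`, `g`
  continuous on `(0, ∞)`;
* `eta` is continuous on `(0, ∞)` and attains every value of `(0,1)` (`stub_rectangleFamily`).

Conclusion (`stub_clusterLawOfComparison_abstract`, the registered helper stub of this file):
there is `f : ℝ → ℝ`, continuous on `(0,1)` with `f (1 - η) = 1 - f η` there, such that every
sequence `v` whose `j`-shift `i ↦ v (j + i)` is a ladder of modulus `t` converges to `f t` along
`k n` (in the application: the shifted ladders `h 2^j / 2^(κ (σ n))` of a lattice polygon).
Proof: `f := g ∘ W` with `eta (W t) = t`; ×2-consistency (`shift_close`), transfer from dyadic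
boxes to ladders (`transfer`), well-definedness up to `ε` (`dyadic_close`, `real_close`),
symmetry through the bottom–top boxes and uniqueness of limits.  No percolation estimate and no
conformal map enters this file.

References: B. Bollobás, O. Riordan, *Percolation* (2006), Ch. 7 §7.1 (the box families and the
role of continuity in the aspect ratio); the scheme is the line's own bookkeeping.
-/

noncomputable section
open Filter Set Metric Topology

namespace Summit.CriticalPhenomena.CardyFormulaZ2.Cruxes.DyadicLatticeBetaLaw.Stubs

namespace ClusterLaw

/-! ### Generic limit lemmas -/

/-- A sequence which is eventually `ε`-close to a convergent one, for every `ε > 0`, converges to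
the same limit. [folklore] -/
theorem tendsto_of_eventually_abs_sub_lt {v v' : ℕ → ℝ} {l : ℝ} (hv : Tendsto v atTop (𝓝 l))
    (h : ∀ ε : ℝ, 0 < ε → ∀ᶠ n in atTop, |v n - v' n| < ε) : Tendsto v' atTop (𝓝 l) := by
  refine hv.congr_dist (Metric.tendsto_nhds.2 fun ε hε => ?_)
  filter_upwards [h ε hε] with n hn
  rwa [Real.dist_eq, sub_zero, Real.dist_eq, abs_abs]

/-- If `v → l` and `v` is eventually within `c` of `M`, then `|l - M| ≤ c`. [folklore] -/
theorem abs_sub_le_of_tendsto {v : ℕ → ℝ} {l M c : ℝ} (hv : Tendsto v atTop (𝓝 l))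
    (h : ∀ᶠ n in atTop, |v n - M| < c) : |l - M| ≤ c :=
  le_of_tendsto ((hv.sub_const M).abs) (h.mono fun _ hn => hn.le)

/-- **Dyadic density**: every `w₀ ≥ 0` is within any `ρ > 0` of a positive dyadic rational
`a / 2^m` (`a ≥ 1`). [folklore] -/
theorem exists_dyadic_near {w₀ ρ : ℝ} (hw₀ : 0 ≤ w₀) (hρ : 0 < ρ) :
    ∃ a m : ℕ, 0 < a ∧ |(a : ℝ) / 2 ^ m - w₀| < ρ := by
  obtain ⟨m, hm⟩ := exists_pow_lt_of_lt_one hρ (by norm_num : (1 / 2 : ℝ) < 1)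
  rw [one_div_pow] at hm
  have h2 : (0 : ℝ) < 2 ^ m := by positivity
  refine ⟨⌊w₀ * 2 ^ m⌋₊ + 1, m, Nat.succ_pos _, lt_of_le_of_lt ?_ hm⟩
  have hfl := Nat.floor_le (mul_nonneg hw₀ h2.le)
  have hlt := Nat.lt_floor_add_one (w₀ * 2 ^ m)
  have key : |(((⌊w₀ * 2 ^ m⌋₊ + 1 : ℕ) : ℝ) - w₀ * 2 ^ m)| ≤ 1 := by
    rw [abs_le]; push_cast; constructor <;> linarith
  rw [show (((⌊w₀ * 2 ^ m⌋₊ + 1 : ℕ) : ℝ)) / 2 ^ m - w₀ =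
      ((((⌊w₀ * 2 ^ m⌋₊ + 1 : ℕ) : ℝ)) - w₀ * 2 ^ m) / 2 ^ m by
    rw [sub_div, mul_div_assoc, div_self h2.ne', mul_one], abs_div, abs_of_pos h2]
  gcongr

/-! ### The abstract comparison scheme -/

variable {L : ℝ → (ℕ → ℝ) → Prop} {eta g : ℝ → ℝ} {b b' : ℝ → ℕ → ℝ} {k : ℕ → ℕ}

/-- **×2-consistency along the ladder.** From the comparison hypothesis applied to a ladder `u`
and its `j`-fold refinement (same modulus): `u (k n - j)` and `u (k n)` are eventually `ε`-close.
[folklore] -/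
theorem shift_close
    (hE : ∀ ε : ℝ, 0 < ε → ∀ t ∈ Ioo (0 : ℝ) 1, ∃ θ : ℝ, 0 < θ ∧
      ∀ (t₁ t₂ : ℝ) (u₁ u₂ : ℕ → ℝ), L t₁ u₁ → L t₂ u₂ → |t₁ - t| < θ → |t₂ - t| < θ →
        ∀ᶠ i : ℕ in atTop, |u₁ i - u₂ i| < ε)
    (hS : ∀ (t : ℝ) (u : ℕ → ℝ), L t u → ∀ j : ℕ, L t (fun i => u (j + i)))
    (hI : ∀ (t : ℝ) (u : ℕ → ℝ), L t u → t ∈ Ioo (0 : ℝ) 1)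
    (hk : Tendsto k atTop atTop) {t : ℝ} {u : ℕ → ℝ} (hu : L t u) (j : ℕ) {ε : ℝ} (hε : 0 < ε) :
    ∀ᶠ n in atTop, |u (k n - j) - u (k n)| < ε := by
  obtain ⟨θ, hθ, hθE⟩ := hE ε hε t (hI t u hu)
  have h0 : |t - t| < θ := by rwa [sub_self, abs_zero]
  have hev := hθE t t u _ hu (hS t u hu j) h0 h0
  have h1 : ∀ᶠ n in atTop, |u (k n - j) - u (j + (k n - j))| < ε :=
    ((tendsto_sub_atTop_nat j).comp hk).eventually hev
  filter_upwards [h1, hk.eventually_ge_atTop j] with n hn hjn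
  rwa [Nat.add_sub_of_le hjn] at hn

/-- **The shifted box sequences converge**: for a dyadic width `w = a/2^m`, along `n ↦ m + k n`
the left–right box sequence still tends to `g w` and the bottom–top one to `1 - g w`
(×2-consistency of the `m`-shifted box ladders). [folklore] -/
theorem box_tendsto
    (hE : ∀ ε : ℝ, 0 < ε → ∀ t ∈ Ioo (0 : ℝ) 1, ∃ θ : ℝ, 0 < θ ∧
      ∀ (t₁ t₂ : ℝ) (u₁ u₂ : ℕ → ℝ), L t₁ u₁ → L t₂ u₂ → |t₁ - t| < θ → |t₂ - t| < θ →
        ∀ᶠ i : ℕ in atTop, |u₁ i - u₂ i| < ε)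
    (hS : ∀ (t : ℝ) (u : ℕ → ℝ), L t u → ∀ j : ℕ, L t (fun i => u (j + i)))
    (hI : ∀ (t : ℝ) (u : ℕ → ℝ), L t u → t ∈ Ioo (0 : ℝ) 1)
    (hB : ∀ a m : ℕ, 0 < a → L (eta ((a : ℝ) / 2 ^ m)) (fun i => b ((a : ℝ) / 2 ^ m) (m + i)) ∧
      L (1 - eta ((a : ℝ) / 2 ^ m)) (fun i => b' ((a : ℝ) / 2 ^ m) (m + i)))
    (hT : ∀ w : ℝ, 0 < w → Tendsto (fun n => b w (k n)) atTop (𝓝 (g w)) ∧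
      Tendsto (fun n => b' w (k n)) atTop (𝓝 (1 - g w)))
    (hk : Tendsto k atTop atTop) {a : ℕ} (m : ℕ) (ha : 0 < a) :
    Tendsto (fun n => b ((a : ℝ) / 2 ^ m) (m + k n)) atTop (𝓝 (g ((a : ℝ) / 2 ^ m))) ∧
      Tendsto (fun n => b' ((a : ℝ) / 2 ^ m) (m + k n)) atTop (𝓝 (1 - g ((a : ℝ) / 2 ^ m))) := by
  have hw : (0 : ℝ) < a / 2 ^ m := by positivity
  obtain ⟨h1, h2⟩ := hT _ hw
  obtain ⟨hL1, hL2⟩ := hB a m ha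
  constructor
  · refine tendsto_of_eventually_abs_sub_lt h1 fun ε hε => ?_
    filter_upwards [shift_close hE hS hI hk hL1 m hε, hk.eventually_ge_atTop m] with n hn hmn
    rwa [Nat.add_sub_of_le hmn] at hn
  · refine tendsto_of_eventually_abs_sub_lt h2 fun ε hε => ?_
    filter_upwards [shift_close hE hS hI hk hL2 m hε, hk.eventually_ge_atTop m] with n hn hmn
    rwa [Nat.add_sub_of_le hmn] at hn

/-- **Transfer from dyadic boxes to ladders.** With `θ = θ(ε, t)` of the comparison hypothesis: a
ladder of modulus `θ`-close to `t` is eventually `2ε`-close to `g w` for every dyadic width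
`w = a/2^m` of modulus `θ`-close to `t`. [folklore] -/
theorem transfer
    (hE : ∀ ε : ℝ, 0 < ε → ∀ t ∈ Ioo (0 : ℝ) 1, ∃ θ : ℝ, 0 < θ ∧
      ∀ (t₁ t₂ : ℝ) (u₁ u₂ : ℕ → ℝ), L t₁ u₁ → L t₂ u₂ → |t₁ - t| < θ → |t₂ - t| < θ →
        ∀ᶠ i : ℕ in atTop, |u₁ i - u₂ i| < ε)
    (hS : ∀ (t : ℝ) (u : ℕ → ℝ), L t u → ∀ j : ℕ, L t (fun i => u (j + i)))
    (hI : ∀ (t : ℝ) (u : ℕ → ℝ), L t u → t ∈ Ioo (0 : ℝ) 1)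
    (hB : ∀ a m : ℕ, 0 < a → L (eta ((a : ℝ) / 2 ^ m)) (fun i => b ((a : ℝ) / 2 ^ m) (m + i)) ∧
      L (1 - eta ((a : ℝ) / 2 ^ m)) (fun i => b' ((a : ℝ) / 2 ^ m) (m + i)))
    (hT : ∀ w : ℝ, 0 < w → Tendsto (fun n => b w (k n)) atTop (𝓝 (g w)) ∧
      Tendsto (fun n => b' w (k n)) atTop (𝓝 (1 - g w)))
    (hk : Tendsto k atTop atTop) {ε t θ : ℝ} (hε : 0 < ε)
    (hθ : ∀ (t₁ t₂ : ℝ) (u₁ u₂ : ℕ → ℝ), L t₁ u₁ → L t₂ u₂ → |t₁ - t| < θ → |t₂ - t| < θ →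
      ∀ᶠ i : ℕ in atTop, |u₁ i - u₂ i| < ε)
    {t₁ : ℝ} {u : ℕ → ℝ} (hu : L t₁ u) (ht₁ : |t₁ - t| < θ) {a m : ℕ} (ha : 0 < a)
    (hw : |eta ((a : ℝ) / 2 ^ m) - t| < θ) :
    ∀ᶠ n in atTop, |u (k n) - g ((a : ℝ) / 2 ^ m)| < 2 * ε := by
  have hev := hθ t₁ _ u _ hu (hB a m ha).1 ht₁ hw
  have hlim := (box_tendsto hE hS hI hB hT hk m ha).1
  filter_upwards [hk.eventually hev, Metric.tendsto_nhds.1 hlim ε hε] with n h1 h2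
  rw [Real.dist_eq] at h2
  have := abs_sub_le (u (k n)) (b ((a : ℝ) / 2 ^ m) (m + k n)) (g ((a : ℝ) / 2 ^ m))
  linarith

/-- **`g` is constant up to `2ε` on dyadic widths of `θ(ε,t)`-equal modulus** (transfer applied to
a box ladder, uniqueness of limits up to `2ε`). [folklore] -/
theorem dyadic_close
    (hE : ∀ ε : ℝ, 0 < ε → ∀ t ∈ Ioo (0 : ℝ) 1, ∃ θ : ℝ, 0 < θ ∧
      ∀ (t₁ t₂ : ℝ) (u₁ u₂ : ℕ → ℝ), L t₁ u₁ → L t₂ u₂ → |t₁ - t| < θ → |t₂ - t| < θ →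
        ∀ᶠ i : ℕ in atTop, |u₁ i - u₂ i| < ε)
    (hS : ∀ (t : ℝ) (u : ℕ → ℝ), L t u → ∀ j : ℕ, L t (fun i => u (j + i)))
    (hI : ∀ (t : ℝ) (u : ℕ → ℝ), L t u → t ∈ Ioo (0 : ℝ) 1)
    (hB : ∀ a m : ℕ, 0 < a → L (eta ((a : ℝ) / 2 ^ m)) (fun i => b ((a : ℝ) / 2 ^ m) (m + i)) ∧
      L (1 - eta ((a : ℝ) / 2 ^ m)) (fun i => b' ((a : ℝ) / 2 ^ m) (m + i)))
    (hT : ∀ w : ℝ, 0 < w → Tendsto (fun n => b w (k n)) atTop (𝓝 (g w)) ∧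
      Tendsto (fun n => b' w (k n)) atTop (𝓝 (1 - g w)))
    (hk : Tendsto k atTop atTop) {ε t θ : ℝ} (hε : 0 < ε)
    (hθ : ∀ (t₁ t₂ : ℝ) (u₁ u₂ : ℕ → ℝ), L t₁ u₁ → L t₂ u₂ → |t₁ - t| < θ → |t₂ - t| < θ →
      ∀ᶠ i : ℕ in atTop, |u₁ i - u₂ i| < ε)
    {a₁ m₁ a₂ m₂ : ℕ} (ha₁ : 0 < a₁) (ha₂ : 0 < a₂) (h₁ : |eta ((a₁ : ℝ) / 2 ^ m₁) - t| < θ)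
    (h₂ : |eta ((a₂ : ℝ) / 2 ^ m₂) - t| < θ) :
    |g ((a₁ : ℝ) / 2 ^ m₁) - g ((a₂ : ℝ) / 2 ^ m₂)| ≤ 2 * ε :=
  abs_sub_le_of_tendsto (box_tendsto hE hS hI hB hT hk m₁ ha₁).1
    (transfer hE hS hI hB hT hk hε hθ (hB a₁ m₁ ha₁).1 h₁ ha₂ h₂)

/-- **Dyadic approximation of a real width**: near every `w₀ > 0` there is a dyadic width whose
modulus is `θ`-close to that of `w₀` and whose `g`-value is `e`-close (continuity of `eta` and
of `g`, dyadic density). [folklore] -/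
theorem exists_dyadic_approx (hg : ContinuousOn g (Ioi 0))
    (heta : ∀ w₀ : ℝ, 0 < w₀ → ∀ ε : ℝ, 0 < ε → ∃ ρ : ℝ, 0 < ρ ∧ ∀ w : ℝ, 0 < w →
      |w - w₀| < ρ → |eta w - eta w₀| < ε)
    {w₀ θ e : ℝ} (hw₀ : 0 < w₀) (hθ : 0 < θ) (he : 0 < e) :
    ∃ a m : ℕ, 0 < a ∧ |eta ((a : ℝ) / 2 ^ m) - eta w₀| < θ ∧ |g ((a : ℝ) / 2 ^ m) - g w₀| < e := by
  obtain ⟨ρ₁, hρ₁, h₁⟩ := heta w₀ hw₀ θ hθ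
  obtain ⟨ρ₂, hρ₂, h₂⟩ :=
    Metric.continuousAt_iff.1 (hg.continuousAt (isOpen_Ioi.mem_nhds hw₀)) e he
  obtain ⟨a, m, ha, hnear⟩ := exists_dyadic_near hw₀.le (lt_min hρ₁ hρ₂)
  have hw : (0 : ℝ) < a / 2 ^ m := by positivity
  refine ⟨a, m, ha, h₁ _ hw (lt_of_lt_of_le hnear (min_le_left _ _)), ?_⟩
  have := h₂ (show dist ((a : ℝ) / 2 ^ m) w₀ < ρ₂ by
    rw [Real.dist_eq]; exact lt_of_lt_of_le hnear (min_le_right _ _))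
  rwa [Real.dist_eq] at this

/-- **`g` is constant up to `4ε` on real widths of `θ(ε,t)`-equal modulus** (dyadic
approximation + `dyadic_close`). [folklore] -/
theorem real_close
    (hE : ∀ ε : ℝ, 0 < ε → ∀ t ∈ Ioo (0 : ℝ) 1, ∃ θ : ℝ, 0 < θ ∧
      ∀ (t₁ t₂ : ℝ) (u₁ u₂ : ℕ → ℝ), L t₁ u₁ → L t₂ u₂ → |t₁ - t| < θ → |t₂ - t| < θ →
        ∀ᶠ i : ℕ in atTop, |u₁ i - u₂ i| < ε)
    (hS : ∀ (t : ℝ) (u : ℕ → ℝ), L t u → ∀ j : ℕ, L t (fun i => u (j + i)))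
    (hI : ∀ (t : ℝ) (u : ℕ → ℝ), L t u → t ∈ Ioo (0 : ℝ) 1)
    (hB : ∀ a m : ℕ, 0 < a → L (eta ((a : ℝ) / 2 ^ m)) (fun i => b ((a : ℝ) / 2 ^ m) (m + i)) ∧
      L (1 - eta ((a : ℝ) / 2 ^ m)) (fun i => b' ((a : ℝ) / 2 ^ m) (m + i)))
    (hT : ∀ w : ℝ, 0 < w → Tendsto (fun n => b w (k n)) atTop (𝓝 (g w)) ∧
      Tendsto (fun n => b' w (k n)) atTop (𝓝 (1 - g w)))
    (hg : ContinuousOn g (Ioi 0))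
    (heta : ∀ w₀ : ℝ, 0 < w₀ → ∀ ε : ℝ, 0 < ε → ∃ ρ : ℝ, 0 < ρ ∧ ∀ w : ℝ, 0 < w →
      |w - w₀| < ρ → |eta w - eta w₀| < ε)
    (hk : Tendsto k atTop atTop) {ε t θ : ℝ} (hε : 0 < ε)
    (hθ : ∀ (t₁ t₂ : ℝ) (u₁ u₂ : ℕ → ℝ), L t₁ u₁ → L t₂ u₂ → |t₁ - t| < θ → |t₂ - t| < θ →
      ∀ᶠ i : ℕ in atTop, |u₁ i - u₂ i| < ε)
    {w₁ w₂ : ℝ} (hw₁ : 0 < w₁) (hw₂ : 0 < w₂) (h₁ : |eta w₁ - t| < θ) (h₂ : |eta w₂ - t| < θ) :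
    |g w₁ - g w₂| ≤ 4 * ε := by
  obtain ⟨a₁, m₁, ha₁, hη₁, hg₁⟩ := exists_dyadic_approx hg heta hw₁ (sub_pos.2 h₁) hε
  obtain ⟨a₂, m₂, ha₂, hη₂, hg₂⟩ := exists_dyadic_approx hg heta hw₂ (sub_pos.2 h₂) hε
  have k₁ : |eta ((a₁ : ℝ) / 2 ^ m₁) - t| < θ := by
    have := abs_sub_le (eta ((a₁ : ℝ) / 2 ^ m₁)) (eta w₁) t
    linarith
  have k₂ : |eta ((a₂ : ℝ) / 2 ^ m₂) - t| < θ := by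
    have := abs_sub_le (eta ((a₂ : ℝ) / 2 ^ m₂)) (eta w₂) t
    linarith
  have hd := dyadic_close hE hS hI hB hT hk hε hθ ha₁ ha₂ k₁ k₂
  have e₁ := abs_sub_le (g w₁) (g ((a₁ : ℝ) / 2 ^ m₁)) (g w₂)
  have e₂ := abs_sub_le (g ((a₁ : ℝ) / 2 ^ m₁)) (g ((a₂ : ℝ) / 2 ^ m₂)) (g w₂)
  rw [abs_sub_comm] at hg₁
  linarith

end ClusterLaw

open ClusterLaw in
/-- **Abstract cluster law from comparison** (registered helper stub of stub S5b
`stub_clusterLawOfComparison`, line `Sketch`).  Let `L t u` be a class of "ladders" (sequences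
`u : ℕ → ℝ` with a modulus `t`), `b w`, `b' w : ℕ → ℝ` two box families with modulus map `eta`,
`k : ℕ → ℕ` a divergent index sequence and `g` the box limits along it.  Assume: (comparison)
for every `ε > 0`, `t ∈ (0,1)` there is `θ > 0` such that two ladders of moduli `θ`-close to `t`
are eventually `ε`-close; shifts of ladders are ladders of the same modulus; moduli of ladders lie
in `(0,1)`; for dyadic `w = a/2^m` the `m`-shifted box sequences are ladders of modulus `eta w`,
resp. `1 - eta w`; `b w (k n) → g w` and `b' w (k n) → 1 - g w` for every `w > 0`; `g` and `eta`
are continuous on `(0, ∞)` and `eta` attains every value in `(0,1)`.  Then there is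
`f : ℝ → ℝ`, continuous on `(0,1)`, with `f (1 - η) = 1 - f η` on `(0,1)`, such that every sequence
`v` whose `j`-shift `i ↦ v (j + i)` is a ladder of modulus `t` satisfies `v (k n) → f t`.
(`f := g ∘ W`, `eta ∘ W = id`;
×2-consistency, transfer, well-definedness up to `ε`, symmetry by uniqueness of limits of the
bottom–top box ladders.) [cite: BollobasRiordan2006, Ch. 7 §7.1] -/
theorem stub_clusterLawOfComparison_abstract :
    ∀ (L : ℝ → (ℕ → ℝ) → Prop) (eta g : ℝ → ℝ) (b b' : ℝ → ℕ → ℝ) (k : ℕ → ℕ),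
      (∀ ε : ℝ, 0 < ε → ∀ t ∈ Set.Ioo (0 : ℝ) 1, ∃ θ : ℝ, 0 < θ ∧
        ∀ (t₁ t₂ : ℝ) (u₁ u₂ : ℕ → ℝ), L t₁ u₁ → L t₂ u₂ → |t₁ - t| < θ → |t₂ - t| < θ →
          ∀ᶠ i : ℕ in atTop, |u₁ i - u₂ i| < ε) →
      (∀ (t : ℝ) (u : ℕ → ℝ), L t u → ∀ j : ℕ, L t (fun i => u (j + i))) →
      (∀ (t : ℝ) (u : ℕ → ℝ), L t u → t ∈ Set.Ioo (0 : ℝ) 1) →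
      (∀ a m : ℕ, 0 < a → L (eta ((a : ℝ) / 2 ^ m)) (fun i => b ((a : ℝ) / 2 ^ m) (m + i)) ∧
        L (1 - eta ((a : ℝ) / 2 ^ m)) (fun i => b' ((a : ℝ) / 2 ^ m) (m + i))) →
      (∀ w : ℝ, 0 < w → Tendsto (fun n => b w (k n)) atTop (𝓝 (g w)) ∧
        Tendsto (fun n => b' w (k n)) atTop (𝓝 (1 - g w))) →
      ContinuousOn g (Set.Ioi 0) →
      (∀ w₀ : ℝ, 0 < w₀ → ∀ ε : ℝ, 0 < ε → ∃ ρ : ℝ, 0 < ρ ∧ ∀ w : ℝ, 0 < w →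
        |w - w₀| < ρ → |eta w - eta w₀| < ε) →
      (∀ t ∈ Set.Ioo (0 : ℝ) 1, ∃ w : ℝ, 0 < w ∧ eta w = t) →
      Tendsto k atTop atTop →
      ∃ f : ℝ → ℝ, ContinuousOn f (Set.Ioo 0 1) ∧ (∀ η ∈ Set.Ioo (0 : ℝ) 1, f (1 - η) = 1 - f η) ∧
        ∀ (t : ℝ) (u : ℕ → ℝ), L t u → ∀ (j : ℕ) (v : ℕ → ℝ), (∀ i : ℕ, v (j + i) = u i) →
          Tendsto (fun n => v (k n)) atTop (𝓝 (f t)) := by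
  intro L eta g b b' k hE hS hI hB hT hg heta hsurj hk
  choose! W hW0 hWη using hsurj
  -- every ladder of modulus `t` converges along `k n` to `g (W t)`
  have core : ∀ (t : ℝ) (u : ℕ → ℝ), L t u → Tendsto (fun n => u (k n)) atTop (𝓝 (g (W t))) := by
    intro t u hu
    have ht := hI t u hu
    rw [Metric.tendsto_nhds]
    intro ε' hε'
    have hε : (0 : ℝ) < ε' / 3 := by positivity
    obtain ⟨θ, hθ, hθE⟩ := hE (ε' / 3) hε t ht
    obtain ⟨a, m, ha, hη, hga⟩ := exists_dyadic_approx hg heta (hW0 t ht) hθ hε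
    rw [hWη t ht] at hη
    have h0 : |t - t| < θ := by rwa [sub_self, abs_zero]
    filter_upwards [transfer hE hS hI hB hT hk hε hθE hu h0 ha hη] with n hn
    rw [Real.dist_eq]
    have := abs_sub_le (u (k n)) (g ((a : ℝ) / 2 ^ m)) (g (W t))
    linarith
  -- continuity of `g ∘ W` on `(0,1)`
  have cont : ContinuousOn (fun t => g (W t)) (Ioo 0 1) := by
    rw [Metric.continuousOn_iff]
    intro t ht ε' hε'
    have hε : (0 : ℝ) < ε' / 5 := by positivity
    obtain ⟨θ, hθ, hθE⟩ := hE (ε' / 5) hε t ht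
    refine ⟨θ, hθ, fun t' ht' hd => ?_⟩
    rw [Real.dist_eq] at hd ⊢
    have h1 : |eta (W t') - t| < θ := by rwa [hWη t' ht']
    have h2 : |eta (W t) - t| < θ := by rwa [hWη t ht, sub_self, abs_zero]
    have := real_close hE hS hI hB hT hg heta hk hε hθE (hW0 t' ht') (hW0 t ht) h1 h2
    show |g (W t') - g (W t)| < ε'
    linarith
  refine ⟨fun t => g (W t), cont, fun t ht => ?_, fun t u hu j v hv => ?_⟩
  · -- symmetry, through the bottom–top boxes of a dyadic width near `W t`
    show g (W (1 - t)) = 1 - g (W t)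
    have ht' : 1 - t ∈ Ioo (0 : ℝ) 1 := ⟨by linarith [ht.2], by linarith [ht.1]⟩
    refine eq_of_forall_dist_le fun ε hε => ?_
    have hε2 : (0 : ℝ) < ε / 2 := by positivity
    obtain ⟨δ, hδ, hδf⟩ :=
      Metric.continuousAt_iff.1 (cont.continuousAt (isOpen_Ioo.mem_nhds ht')) (ε / 2) hε2
    obtain ⟨a, m, ha, hη, hga⟩ := exists_dyadic_approx hg heta (hW0 t ht) hδ hε2
    rw [hWη t ht] at hη
    -- the bottom–top box ladder of width `a/2^m` has modulus `1 - eta (a/2^m)`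
    have hlim1 := (box_tendsto hE hS hI hB hT hk m ha).2
    have hlim2 := core (1 - eta ((a : ℝ) / 2 ^ m)) _ (hB a m ha).2
    have heq : g (W (1 - eta ((a : ℝ) / 2 ^ m))) = 1 - g ((a : ℝ) / 2 ^ m) :=
      tendsto_nhds_unique hlim2 hlim1
    have hcont := hδf (show dist (1 - eta ((a : ℝ) / 2 ^ m)) (1 - t) < δ by
      rw [Real.dist_eq, show (1 - eta ((a : ℝ) / 2 ^ m)) - (1 - t) = -(eta ((a : ℝ) / 2 ^ m) - t)
        by ring, abs_neg]; exact hη)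
    rw [Real.dist_eq] at hcont ⊢
    have e3 : |(1 - g ((a : ℝ) / 2 ^ m)) - (1 - g (W t))| < ε / 2 := by
      rw [show (1 - g ((a : ℝ) / 2 ^ m)) - (1 - g (W t)) = -(g ((a : ℝ) / 2 ^ m) - g (W t)) by ring,
        abs_neg]; exact hga
    rw [← heq] at e3
    have e4 : |g (W (1 - t)) - g (W (1 - eta ((a : ℝ) / 2 ^ m)))| < ε / 2 := by
      rw [abs_sub_comm]; exact hcont
    have := abs_sub_le (g (W (1 - t))) (g (W (1 - eta ((a : ℝ) / 2 ^ m)))) (1 - g (W t))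
    linarith
  · -- every sequence whose `j`-shift is a ladder converges along `k n` to `g (W t)`
    have h1 : Tendsto (fun n => u (k n - j)) atTop (𝓝 (g (W t))) := by
      refine tendsto_of_eventually_abs_sub_lt (core t u hu) fun ε hε => ?_
      filter_upwards [shift_close hE hS hI hk hu j hε] with n hn
      rwa [abs_sub_comm] at hn
    refine h1.congr' ?_
    filter_upwards [hk.eventually_ge_atTop j] with n hn
    rw [← hv, Nat.add_sub_of_le hn]

end Summit.CriticalPhenomena.CardyFormulaZ2.Cruxes.DyadicLatticeBetaLaw.Stubs

end
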